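import Literature.AlgebraicGeometry.Motives.AbelianVarietyTorsionPointsAlgClosed
import Literature.AlgebraicGeometry.Motives.AbelianVarietyBaseChange
import Literature.AlgebraicGeometry.HodgeTheory.AbelianVarietyTateModuleComparison
import Literature.NumberTheory.EllipticCurves.TateModuleBaseChange
import Mathlib.Algebra.Ring.CharZero
import HarnessLib

/-!
# The Tate module along an extension of the ground field: `T_ℓ(A) ≃ T_ℓ(A(Ω))` and
# `T_ℓ(A) ≃ T_ℓ(A ×_k ℂ)` (Serre–Tate 1968 §1; Lang 1982 Ch. VII §2; Mumford §19)

Topic `Literature/AlgebraicGeometry/Motives`, namespace `Literature.AlgebraicGeometry.Motives.AbelianVariety`.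
DEFINITIONS WITH BODIES and THEOREMS, all proved; no named fact, no instance, no notation (net Literature
debt 0).  Written for the cell `hodgecm-mathlib` (D-0151), interface row VI-2″ «TateModuleBaseChangeAlong»
(B-typ04 IFACE-ROW 2026-08-28T01:47:33Z), the leg `T_ℓ(A_{\bar k}) ≅ T_ℓ(A ×_k ℂ)` of the degree-one
Betti–étale comparison (`Liu2021/AppendixC/EtaleBettiComparison`, named fact `exists_h1ComparisonFamily`).

For an abelian variety `A` over a field `k`, `k̄ = AlgebraicClosure k`, and a field `Ω` containing `k̄`
(`[Algebra k Ω] [Algebra k̄ Ω] [IsScalarTower k k̄ Ω]`):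

* §1 `geomPointsExtend A Ω : A(k̄) →+ A(Ω)` — extension of scalars of geometric points, additively
  written (the tree's `AlgPoints.extendScalarsMonoidHom`); injective (`AlgPoints.extendScalars_injective`),
  natural in homomorphisms `f : A ⟶ B` (`geomPointsExtend_geomPointsMap`), and — for `Ω` algebraically
  closed and `k` of characteristic `0` — ONTO the `ℓ`-power torsion (`exists_geomPointsExtend_eq_of_smul_eq_zero`:
  the tree's `exists_extendScalars_eq_of_mem_torsionPoints`, «`A_m ⊂ A(K_s)`», Serre–Tate §1).
* §2 **`tateModuleExtendEquiv A Ω ℓ : A.tateModule ℓ ≃ₗ[ℤ_[ℓ]] TateModule (Additive (A.Points Ω)) ℓ`** —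
  `T_ℓ(A) = lim A[ℓ^r](k̄) ⥲ lim A[ℓ^r](Ω)` (the tree's generic `TateModule.mapEquivOfTorsion`), with
  components `(e a)_r = (a_r)_Ω` and NATURALITY `e_B ∘ T_ℓ(f) = T_ℓ(f(Ω)) ∘ e_A`
  (`tateModuleExtendEquiv_tateModuleMap`).
* §3 over `Ω = ℂ` (any `[Algebra k ℂ]`, e.g. `τ'.toAlgebra` for an embedding `τ' : k →+* ℂ`):
  `pointsAddEquiv A L : Additive (A.Points L) ≃+ Additive ((A.baseChange L).Points L)` (the tree's
  `pointsMulEquiv`, naturality `pointsMulEquiv_map`), **`tateModulePointsEquiv A ℓ : A.tateModule ℓ ≃ₗ[ℤ_[ℓ]]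
  TateModule (Additive ((A.baseChange ℂ).Points ℂ)) ℓ`** (the TOPOLOGICAL Tate module of the complex points
  of `A ×_k ℂ`, target of the tree's `HodgeTheory.AbelianVariety.hOneToTate`) and **`tateModuleBaseChangeEquiv
  A ℓ : A.tateModule ℓ ≃ₗ[ℤ_[ℓ]] (A.baseChange ℂ).tateModule ℓ`** (composed with the PROVED comparison
  `HodgeTheory.AbelianVariety.tateModuleComparison`), both natural in `f : A ⟶ B` against
  `Hom.baseChange ℂ f` (`tateModulePointsEquiv_tateModuleMap`, `tateModuleMap_tateModuleBaseChangeEquiv`):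
  «`T_ℓ(A) ≅ T_ℓ(A ⊗_{k,τ'} ℂ)`, `End_k(A)`-equivariantly».

* §4 Galois equivariance: `T_ℓ(A) ≃ T_ℓ(A(Ω))` transports the `Γ_k`-action (`AbelianVariety.tateRep`) to the action
  of `Aut(Ω/k)` on `A(Ω)` along the restriction `Aut(Ω/k) → Γ_k` defined by `k̄ → Ω`
  (`toMul_geomPointsExtend_smul`, `toMul_proj_tateModuleExtendEquiv_tateRep`), parameter-free through Mathlib's
  restriction `AlgEquiv.restrictNormal : Aut(Ω/k) → Gal(k̄/k)` (`toMul_proj_tateModuleExtendEquiv_tateRep_restrictNormal`).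

The embedding `k̄ → Ω` is a PARAMETER (an instance argument); for `Ω` algebraically closed over `k` one
exists (`IsAlgClosed.lift`), see `algebraicClosureAlgHom`.  Characteristic `0` of `k` is automatic from
`[Algebra k ℂ]` (`RingHom.charZero`) and is only used through `(ℓ^r : k) ≠ 0`.

## References

* [SerreTate1968] J.-P. Serre, J. Tate, *Good reduction of abelian varieties*, Ann. of Math. 88 (1968), §1
  p. 493 (`A_m`, `T_ℓ(A)` as `Gal(K_s/K)`-modules inside `A(K_s)`).
* [Lang1982AbelianFunctions] S. Lang, *Introduction to Algebraic and Abelian Functions*, 2nd ed. (1982),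
  Ch. VII §1 p. 115 (functoriality of `T_ℓ`), §2 p. 115–116 (`T_ℓ` of a complex torus).
* [MumfordAV1970] D. Mumford, *Abelian Varieties* (1970), §19 p. 171 (`T_ℓ A`), §6 Proposition p. 64.
* [Hartshorne1977] R. Hartshorne, *Algebraic Geometry*, II Ex. 2.7 (points along a field map), II.3 Thm. 3.3.
-/

noncomputable section

open CategoryTheory CategoryTheory.Limits Function AlgebraicGeometry
open Literature.NumberTheory.EllipticCurves (TateModule)

universe u

namespace Literature.AlgebraicGeometry.Motives.AbelianVariety

open scoped MonObj

/-! ## §1 Extension of scalars of geometric points `A(k̄) → A(Ω)` -/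

section Points

variable {k : Type u} [Field k] {A B C : AbelianVariety k} (L : Type u) [Field L] [Algebra k L]

/-- The homomorphism `f(L) : A(L) →+ B(L)`, `P ↦ P ≫ f`, induced on `L`-valued points by a homomorphism of
abelian varieties, additively written (Mathlib `IsMonHom.monoidHom` made additive; for `L = k = ℂ` this is
the tree's `HodgeTheory.AbelianVariety.pointsAddMonoidHom`). [cite: MumfordAV1970, §4 (homomorphisms act on points)] -/
def Hom.pointsAddHom (f : A ⟶ B) : Additive (A.Points L) →+ Additive (B.Points L) :=
  MonoidHom.toAdditive (IsMonHom.monoidHom f.hom.hom.hom (specOver k L))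

/-- `toMul (f(L) P) = toMul P ≫ f`. [cite: MumfordAV1970, §4] -/
@[simp]
theorem Hom.toMul_pointsAddHom (f : A ⟶ B) (P : Additive (A.Points L)) :
    Additive.toMul (Hom.pointsAddHom L f P) = AlgPoints.map f.hom.hom.hom (Additive.toMul P) := rfl

variable (A) (Ω : Type u) [Field Ω] [Algebra k Ω] [Algebra (AlgebraicClosure k) Ω]
  [IsScalarTower k (AlgebraicClosure k) Ω]

/-- **`A(k̄) →+ A(Ω)`**, extension of scalars of geometric points along `k̄ → Ω`, additively written
(the tree's `AlgPoints.extendScalarsMonoidHom`; Serre–Tate §1: `A(K_s) ⊂ A(Ω)`). [cite: SerreTate1968, §1 p. 493] -/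
def geomPointsExtend : A.geomPoints →+ Additive (A.Points Ω) :=
  MonoidHom.toAdditive (AlgPoints.extendScalarsMonoidHom A.X (AlgebraicClosure k) Ω)

/-- `toMul (P_Ω) = extendScalars (toMul P)`. [cite: Hartshorne1977, II Ex. 2.7] -/
@[simp]
theorem toMul_geomPointsExtend (P : A.geomPoints) :
    Additive.toMul (A.geomPointsExtend Ω P) =
      AlgPoints.extendScalars A.X (AlgebraicClosure k) Ω (Additive.toMul P : A.Points (AlgebraicClosure k)) :=
  rfl

/-- `A(k̄) → A(Ω)` is injective. [cite: Hartshorne1977, II Ex. 2.7] -/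
theorem geomPointsExtend_injective : Injective (A.geomPointsExtend Ω) := fun _ _ h ↦
  Additive.toMul.injective (AlgPoints.extendScalars_injective A.X (AlgebraicClosure k) Ω (congrArg Additive.toMul h))

variable {A} in
/-- **Naturality of `A(k̄) → A(Ω)`** in homomorphisms `f : A ⟶ B`: `(f P)_Ω = f(Ω) (P_Ω)` (associativity of
`Spec Ω → Spec k̄ → A → B`). [cite: Hartshorne1977, II Ex. 2.7] -/
theorem geomPointsExtend_geomPointsMap (f : A ⟶ B) (P : A.geomPoints) :
    B.geomPointsExtend Ω (Hom.geomPointsMap f P) = Hom.pointsAddHom Ω f (A.geomPointsExtend Ω P) := by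
  apply Additive.toMul.injective
  rw [toMul_geomPointsExtend, Hom.geomPointsMap_apply, Hom.toMul_pointsAddHom, toMul_geomPointsExtend,
    AlgPoints.map_apply, AlgPoints.map_apply, AlgPoints.extendScalars_apply, AlgPoints.extendScalars_apply,
    Category.assoc]

variable [IsAlgClosed Ω] [CharZero k] (ℓ : ℕ) [Fact ℓ.Prime]

/-- **`A(k̄) → A(Ω)` is onto the `ℓ`-power torsion** (`Ω` algebraically closed, `char k = 0`): every
`b ∈ A(Ω)` with `ℓ^r b = 0` is `a_Ω` for some (torsion) `a ∈ A(k̄)` — the tree's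
`exists_extendScalars_eq_of_mem_torsionPoints` («`A_m ⊂ A(K_s)`»). [cite: SerreTate1968, §1 p. 493] [cite: MumfordAV1970, §6 Proposition p. 64] -/
theorem exists_geomPointsExtend_eq_of_smul_eq_zero (r : ℕ) (b : Additive (A.Points Ω)) (hb : ℓ ^ r • b = 0) :
    ∃ a : A.geomPoints, A.geomPointsExtend Ω a = b := by
  have hmem : Additive.toMul b ∈ A.torsionPoints Ω ((ℓ ^ r : ℕ) : ℤ) := by
    rw [mem_torsionPoints_iff, zpow_natCast, ← toMul_nsmul, hb, toMul_zero]
  have hn : (((ℓ ^ r : ℕ) : ℤ) : k) ≠ 0 := by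
    rw [Int.cast_natCast, Nat.cast_ne_zero]
    exact pow_ne_zero r (Fact.out : ℓ.Prime).ne_zero
  obtain ⟨Q, -, hQ⟩ := A.exists_extendScalars_eq_of_mem_torsionPoints Ω hn hmem
  exact ⟨Additive.ofMul Q, Additive.toMul.injective hQ⟩

/-! ## §2 `T_ℓ(A) ≃ T_ℓ(A(Ω))` -/

/-- **`T_ℓ(A) = lim A[ℓ^r](k̄) ≃ₗ[ℤ_ℓ] lim A[ℓ^r](Ω) = T_ℓ(A(Ω))`** for `Ω ⊇ k̄` algebraically closed
(`char k = 0`): `T_ℓ` of the injection `A(k̄) → A(Ω)`, which is onto the `ℓ`-power torsion (the tree's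
`TateModule.mapEquivOfTorsion`). [cite: SerreTate1968, §1 p. 493] [cite: Lang1982AbelianFunctions, Ch. VII §1, p. 115] -/
def tateModuleExtendEquiv : A.tateModule ℓ ≃ₗ[ℤ_[ℓ]] TateModule (Additive (A.Points Ω)) ℓ :=
  TateModule.mapEquivOfTorsion (A.geomPointsExtend Ω) (A.geomPointsExtend_injective Ω)
    (fun r b hb ↦ A.exists_geomPointsExtend_eq_of_smul_eq_zero Ω ℓ r b hb)

/-- `tateModuleExtendEquiv` is `T_ℓ` of `A(k̄) → A(Ω)`. [cite: Lang1982AbelianFunctions, Ch. VII §1, p. 115] -/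
@[simp]
theorem tateModuleExtendEquiv_apply (a : A.tateModule ℓ) :
    A.tateModuleExtendEquiv Ω ℓ a = TateModule.map ℓ (A.geomPointsExtend Ω) a := rfl

/-- Components: `(e a)_r = (a_r)_Ω`. [cite: Lang1982AbelianFunctions, Ch. VII §1, p. 115] -/
theorem proj_tateModuleExtendEquiv (a : A.tateModule ℓ) (r : ℕ) :
    TateModule.proj ℓ r (A.tateModuleExtendEquiv Ω ℓ a) = A.geomPointsExtend Ω (TateModule.proj ℓ r a) := rfl

variable {A} in
/-- **Naturality: `e_B (T_ℓ(f) a) = T_ℓ(f(Ω)) (e_A a)`** for `f : A ⟶ B` — `T_ℓ(A) ≃ T_ℓ(A(Ω))` is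
`Hom_k(A, B)`-equivariant (in particular `End_k(A)`-equivariant). [cite: Lang1982AbelianFunctions, Ch. VII §2, Thm. 2.1, p. 116] -/
theorem tateModuleExtendEquiv_tateModuleMap (f : A ⟶ B) (a : A.tateModule ℓ) :
    B.tateModuleExtendEquiv Ω ℓ (tateModuleMap ℓ f a) =
      TateModule.map ℓ (Hom.pointsAddHom Ω f) (A.tateModuleExtendEquiv Ω ℓ a) :=
  TateModule.ext fun r ↦ by
    rw [proj_tateModuleExtendEquiv, proj_tateModuleMap, TateModule.proj_map, proj_tateModuleExtendEquiv,
      geomPointsExtend_geomPointsMap]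

end Points

/-! ## §3 `T_ℓ(A) ≃ T_ℓ((A ×_k L)(L))` and `T_ℓ(A) ≃ T_ℓ(A ×_k ℂ)` -/

section BaseChange

variable {k : Type u} [Field k] (A : AbelianVariety k) {B : AbelianVariety k} (L : Type u) [Field L] [Algebra k L]

/-- **`A(L) ≃+ A_L(L)`**, additively written (the tree's `pointsMulEquiv`: the universal property of
`A_L = A ×_k L`, compatibly with the group laws). [cite: Hartshorne1977, II.3 Thm. 3.3] -/
def pointsAddEquiv : Additive (A.Points L) ≃+ Additive ((A.baseChange L).Points L) :=
  MulEquiv.toAdditive (A.pointsMulEquiv L)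

/-- `toMul (pointsAddEquiv P) = pointsMulEquiv (toMul P)`. [cite: Hartshorne1977, II.3 Thm. 3.3] -/
@[simp]
theorem toMul_pointsAddEquiv (P : Additive (A.Points L)) :
    Additive.toMul (A.pointsAddEquiv L P) = A.pointsMulEquiv L (Additive.toMul P) := rfl

variable {A L} in
/-- Two `L`-points of `A_L` with the same composite to `A` are equal (both lie over `Spec L` by the
identity). [cite: Hartshorne1977, II.3 Thm. 3.3] -/
theorem Points.ext_of_comp_pullback_fst {Q₁ Q₂ : (A.baseChange L).Points L}
    (h : Q₁.left ≫ pullback.fst A.X.hom (bcSpec k L) = Q₂.left ≫ pullback.fst A.X.hom (bcSpec k L)) :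
    Q₁ = Q₂ := by
  ext : 1
  apply pullback.hom_ext
  · exact h
  · have h₁ : Q₁.left ≫ (A.baseChange L).X.hom = (specOver L L).hom := Over.w Q₁
    have h₂ : Q₂.left ≫ (A.baseChange L).X.hom = (specOver L L).hom := Over.w Q₂
    exact h₁.trans h₂.symm

variable {A} in
/-- **Naturality of `A(L) ≃ A_L(L)` in `A`**: `(f P)_L = f_L (P_L)` for `f : A ⟶ B` (both lie over `P ≫ f`).
[cite: Hartshorne1977, II.3 Thm. 3.3] -/
theorem pointsMulEquiv_map (f : A ⟶ B) (P : A.Points L) :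
    B.pointsMulEquiv L (AlgPoints.map f.hom.hom.hom P) =
      AlgPoints.map (Hom.baseChange L f).hom.hom.hom (A.pointsMulEquiv L P) := by
  apply Points.ext_of_comp_pullback_fst
  rw [pointsMulEquiv_apply, pointsMulEquiv_apply, pointsEquiv_apply_left_comp_fst, AlgPoints.map_apply,
    AlgPoints.map_apply, Over.comp_left, Over.comp_left, Category.assoc]
  change _ = _ ≫ Hom.toSchemeHom (Hom.baseChange L f) ≫ _
  rw [toSchemeHom_baseChange_comp_fst]
  exact (congrArg (· ≫ Hom.toSchemeHom f) (A.pointsEquiv_apply_left_comp_fst L P)).symm.trans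
    (Category.assoc _ _ _)

variable {A} in
/-- Naturality of `pointsAddEquiv`: `(f P)_L = f_L (P_L)`, additively. [cite: Hartshorne1977, II.3 Thm. 3.3] -/
theorem pointsAddEquiv_pointsAddHom (f : A ⟶ B) (P : Additive (A.Points L)) :
    B.pointsAddEquiv L (Hom.pointsAddHom L f P) =
      Hom.pointsAddHom L (Hom.baseChange L f) (A.pointsAddEquiv L P) := by
  apply Additive.toMul.injective
  rw [toMul_pointsAddEquiv, Hom.toMul_pointsAddHom, Hom.toMul_pointsAddHom, toMul_pointsAddEquiv]
  exact pointsMulEquiv_map L f (Additive.toMul P)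

end BaseChange

section Complex

/-- A field `k` with an algebra map to `ℂ` has characteristic `0` (Mathlib `RingHom.charZero`). [folklore] -/
private theorem charZero_of_algebra_complex (k : Type) [Field k] [Algebra k ℂ] : CharZero k :=
  (algebraMap k ℂ).charZero

variable {k : Type} [Field k] (A : AbelianVariety k) {B : AbelianVariety k} [Algebra k ℂ]
  [Algebra (AlgebraicClosure k) ℂ] [IsScalarTower k (AlgebraicClosure k) ℂ] (ℓ : ℕ) [Fact ℓ.Prime]

/-- **`T_ℓ(A) ≃ₗ[ℤ_ℓ] T_ℓ((A ×_k ℂ)(ℂ))`** — the algebraic Tate module of `A / k` (on `k̄`-points) is the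
TOPOLOGICAL Tate module `lim (A ×_k ℂ)[ℓ^r](ℂ)` of the complex points of the base change (the target of the
tree's `HodgeTheory.AbelianVariety.hOneToTate`): `T_ℓ` of `A(k̄) → A(ℂ) ≃ A_ℂ(ℂ)`.
[cite: SerreTate1968, §1 p. 493] [cite: Lang1982AbelianFunctions, Ch. VII §2, p. 115] -/
def tateModulePointsEquiv : A.tateModule ℓ ≃ₗ[ℤ_[ℓ]] TateModule (Additive ((A.baseChange ℂ).Points ℂ)) ℓ :=
  haveI : CharZero k := charZero_of_algebra_complex k
  (A.tateModuleExtendEquiv ℂ ℓ).trans (TateModule.mapAddEquiv ℓ (A.pointsAddEquiv ℂ))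

/-- Components: `(e a)_r = ((a_r)_ℂ)_{A_ℂ}`. [cite: Lang1982AbelianFunctions, Ch. VII §2, p. 115] -/
@[simp]
theorem proj_tateModulePointsEquiv (a : A.tateModule ℓ) (r : ℕ) :
    TateModule.proj ℓ r (A.tateModulePointsEquiv ℓ a) =
      A.pointsAddEquiv ℂ (A.geomPointsExtend ℂ (TateModule.proj ℓ r a)) := rfl

variable {A} in
/-- **Naturality: `e_B (T_ℓ(f) a) = T_ℓ(f_ℂ(ℂ)) (e_A a)`** for `f : A ⟶ B`, with `f_ℂ = Hom.baseChange ℂ f` and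
`T_ℓ(f_ℂ(ℂ)) = TateModule.map` of the tree's `HodgeTheory.AbelianVariety.pointsAddMonoidHom f_ℂ`.
[cite: Lang1982AbelianFunctions, Ch. VII §2, Thm. 2.1, p. 116] -/
theorem tateModulePointsEquiv_tateModuleMap (f : A ⟶ B) (a : A.tateModule ℓ) :
    B.tateModulePointsEquiv ℓ (tateModuleMap ℓ f a) =
      TateModule.map ℓ (HodgeTheory.AbelianVariety.pointsAddMonoidHom (Hom.baseChange ℂ f))
        (A.tateModulePointsEquiv ℓ a) :=
  TateModule.ext fun r ↦ by
    rw [proj_tateModulePointsEquiv, proj_tateModuleMap, TateModule.proj_map, proj_tateModulePointsEquiv,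
      geomPointsExtend_geomPointsMap, pointsAddEquiv_pointsAddHom]
    rfl

/-- **`T_ℓ(A) ≃ₗ[ℤ_ℓ] T_ℓ(A ×_k ℂ)`** («`T_ℓ(A) ≅ T_ℓ(A ⊗_{k,τ'} ℂ)`», the algebraic Tate modules of the
tree on both sides): `tateModulePointsEquiv` followed by the PROVED complex comparison
`HodgeTheory.AbelianVariety.tateModuleComparison` (`T_ℓ(A_ℂ(ℂ)) ≅ T_ℓ(A_ℂ)`).
[cite: SerreTate1968, §1 p. 493] [cite: Lang1982AbelianFunctions, Ch. VII §2, p. 115] -/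
def tateModuleBaseChangeEquiv : A.tateModule ℓ ≃ₗ[ℤ_[ℓ]] (A.baseChange ℂ).tateModule ℓ :=
  (A.tateModulePointsEquiv ℓ).trans (HodgeTheory.AbelianVariety.tateModuleComparison (A.baseChange ℂ) ℓ)

/-- Unfolding: `tateModuleBaseChangeEquiv = tateModuleComparison ∘ tateModulePointsEquiv`.
[cite: Lang1982AbelianFunctions, Ch. VII §2, p. 115] -/
theorem tateModuleBaseChangeEquiv_apply (a : A.tateModule ℓ) :
    A.tateModuleBaseChangeEquiv ℓ a =
      HodgeTheory.AbelianVariety.tateModuleComparison (A.baseChange ℂ) ℓ (A.tateModulePointsEquiv ℓ a) := rfl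

variable {A} in
/-- **`End_k(A)`/`Hom_k(A, B)`-equivariance of `T_ℓ(A) ≃ T_ℓ(A ×_k ℂ)`**: `T_ℓ(f_ℂ) ∘ e_A = e_B ∘ T_ℓ(f)` for
`f : A ⟶ B` (acting on the right through `Hom.baseChange ℂ`).
[cite: Lang1982AbelianFunctions, Ch. VII §2, Thm. 2.1, p. 116] -/
theorem tateModuleMap_tateModuleBaseChangeEquiv (f : A ⟶ B) (a : A.tateModule ℓ) :
    tateModuleMap ℓ (Hom.baseChange ℂ f) (A.tateModuleBaseChangeEquiv ℓ a) =
      B.tateModuleBaseChangeEquiv ℓ (tateModuleMap ℓ f a) := by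
  rw [tateModuleBaseChangeEquiv_apply, tateModuleBaseChangeEquiv_apply,
    HodgeTheory.AbelianVariety.tateModuleMap_tateModuleComparison, tateModulePointsEquiv_tateModuleMap]

variable (k) in
/-- An embedding `k̄ → ℂ` over `k` exists for any `[Algebra k ℂ]` (`ℂ` is algebraically closed; Mathlib
`IsAlgClosed.lift`) — the parameter `[Algebra k̄ ℂ] [IsScalarTower k k̄ ℂ]` of this file can always be
instantiated (`RingHom.toAlgebra`, `IsScalarTower.of_algebraMap_eq`). [folklore] -/
def algebraicClosureAlgHom : AlgebraicClosure k →ₐ[k] ℂ := IsAlgClosed.lift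

end Complex

/-! ## §4 Galois equivariance: the `Γ_k`-action on `T_ℓ(A)` is the action of `Aut(Ω/k)` on `A(Ω)` -/

section Galois

variable {k : Type u} [Field k] (A : AbelianVariety k) (Ω : Type u) [Field Ω] [Algebra k Ω]
  [Algebra (AlgebraicClosure k) Ω] [IsScalarTower k (AlgebraicClosure k) Ω]

/-- **Galois equivariance of `A(k̄) → A(Ω)`**: if `σ' ∈ Aut(Ω/k)` restricts along `k̄ → Ω` to `g ∈ Γ_k = Gal(k̄/k)`,
then `(g • P)_Ω = σ' • P_Ω` (the tree's `AlgPoints.smul_extendScalars`; Serre–Tate §1: «on which `Gal(K_s/K)` acts»,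
read inside `A(Ω)`). [cite: SerreTate1968, §1 p. 493] [cite: Hartshorne1977, II Ex. 4.7] -/
theorem toMul_geomPointsExtend_smul (g : Field.absoluteGaloisGroup k) (σ' : Ω ≃ₐ[k] Ω)
    (h : ∀ x, σ' (algebraMap (AlgebraicClosure k) Ω x) =
      algebraMap (AlgebraicClosure k) Ω (Field.absoluteGaloisGroup.toAlgEquiv k g x))
    (P : A.geomPoints) :
    Additive.toMul (A.geomPointsExtend Ω (g • P)) = σ' • Additive.toMul (A.geomPointsExtend Ω P) := by
  rw [toMul_geomPointsExtend, toMul_geomPointsExtend, AbelianVariety.toMul_smul, AlgPoints.absoluteGaloisGroup_smul_def,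
    ← AlgPoints.smul_def, AlgPoints.smul_extendScalars A.X (Field.absoluteGaloisGroup.toAlgEquiv k g) σ' h]

variable [IsAlgClosed Ω] [CharZero k] (ℓ : ℕ) [Fact ℓ.Prime]

/-- **`T_ℓ(A) ≃ T_ℓ(A(Ω))` transports the Galois representation `ρ_{A,ℓ}` (`AbelianVariety.tateRep`) to the action
of `Aut(Ω/k)` on the torsion of `A(Ω)`**, componentwise: if `σ' ∈ Aut(Ω/k)` restricts to `g ∈ Γ_k` along `k̄ → Ω`,
then `(e (ρ(g) a))_r = σ' • (e a)_r` for every `r` — «`T_ℓ(A)` is a `Gal`-module via restriction … and as such it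
is the Tate module of the points over `Ω`». [cite: SerreTate1968, §1 p. 493] [cite: Lang1982AbelianFunctions, Ch. VII §1, p. 115] -/
theorem toMul_proj_tateModuleExtendEquiv_tateRep (g : Field.absoluteGaloisGroup k) (σ' : Ω ≃ₐ[k] Ω)
    (h : ∀ x, σ' (algebraMap (AlgebraicClosure k) Ω x) =
      algebraMap (AlgebraicClosure k) Ω (Field.absoluteGaloisGroup.toAlgEquiv k g x))
    (a : A.tateModule ℓ) (r : ℕ) :
    Additive.toMul (TateModule.proj ℓ r (A.tateModuleExtendEquiv Ω ℓ (A.tateRep ℓ g a))) =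
      σ' • Additive.toMul (TateModule.proj ℓ r (A.tateModuleExtendEquiv Ω ℓ a)) := by
  rw [proj_tateModuleExtendEquiv, proj_tateModuleExtendEquiv, AbelianVariety.tateRep_apply_apply,
    TateModule.proj_smul_of_distribMulAction, toMul_geomPointsExtend_smul A Ω g σ' h]

/-- **Parameter-free form: the `Γ_k`-action on `T_ℓ(A)` IS the `Aut(Ω/k)`-action on the torsion of `A(Ω)` through
the restriction homomorphism `Aut(Ω/k) → Gal(k̄/k) = Γ_k`** (Mathlib `AlgEquiv.restrictNormal` along `k̄ → Ω`, read
in `Γ_k` by `Field.absoluteGaloisGroup.toAlgEquiv`): `(e (ρ(σ'|_{k̄}) a))_r = σ' • (e a)_r`.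
[cite: SerreTate1968, §1 p. 493] [cite: Lang1982AbelianFunctions, Ch. VII §1, p. 115] -/
theorem toMul_proj_tateModuleExtendEquiv_tateRep_restrictNormal (σ' : Ω ≃ₐ[k] Ω) (a : A.tateModule ℓ) (r : ℕ) :
    Additive.toMul (TateModule.proj ℓ r (A.tateModuleExtendEquiv Ω ℓ
        (A.tateRep ℓ ((Field.absoluteGaloisGroup.toAlgEquiv k).symm (σ'.restrictNormal (AlgebraicClosure k))) a))) =
      σ' • Additive.toMul (TateModule.proj ℓ r (A.tateModuleExtendEquiv Ω ℓ a)) :=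
  A.toMul_proj_tateModuleExtendEquiv_tateRep Ω ℓ _ σ' (fun x ↦ by
    rw [MulEquiv.apply_symm_apply, AlgEquiv.restrictNormal_commutes]) a r

end Galois

end Literature.AlgebraicGeometry.Motives.AbelianVariety

end
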